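import Literature.MathematicalPhysics.QuantumFieldTheory.ConformalBootstrap3D.RadialConversion
import Literature.Analysis.Complex.PringsheimNonnegativeCoefficients
import Mathlib.Analysis.Complex.LocallyUniformLimit
import Mathlib.Analysis.SpecialFunctions.Complex.Analytic
import Mathlib.Analysis.SpecialFunctions.Pow.Complex
import HarnessLib

/-!
# Radial-frame existence from positivity (Hogervorst–Rychkov 2013 §3.1 made rigorous)

Hogervorst–Rychkov 2013 §3.1 argue that the radial (`ρ`-) expansion of a conformal block converges on
the whole unit `ρ`-disc as follows: "consider first `ρ = 1 - ε` real. For such `ρ` all terms in the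
series are positive, and so the series must converge: a divergence here would mean a physical
singularity for the conformal block, while … all such singularities are confined to `|ρ| = 1`"
[cite: HogervorstRychkov2013, §3.1]. This is the Vivanti–Pringsheim argument
(`Literature.Analysis.Complex.hasSum_mul_pow_of_nonneg_of_analyticAt`), and it needs two inputs:
POSITIVITY of the radial coefficients (in print: reflection positivity in radial quantization,
Hogervorst–Rychkov 2013 eq. (3.4)–(3.5) "`B_{n,j} ≥ 0`"; Costa–Hansen–Penedones–Trevisani 2016 §2.1;
not derivable from the `z`-frame block predicate of the tree) and ANALYTICITY along the real segment.

This file proves the implication POSITIVITY ⇒ EXISTENCE for the objects of the tree, with no appeal to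
the physical picture: the analytic input along the segment is supplied by the `z`-series itself
(which converges on the unit `z`-square), one variable at a time.

Setting (as in `RadialConversion.hasSum_zRhoConv`): a function `G` on the square with a `z`-expansion
`G(x,y) = Σ_q A_q 𝒫_{Δ+n,j}(x,y)` (`q = (n,j)`), `A ≥ 0` supported on `j ≤ ℓ + n`, `ℓ ≤ Δ`, a prefactor
exponent `c`, and the conversion array `d = zRhoConv c Δ ℓ A` (the `(√ρ,√ρ̄)`-monomial array of
`(su)^{-(Δ-ℓ)} 4^{-Δ} ((1-z(s²))(1-z(u²)))^c G(z(s²),z(u²))`, which `hasSum_zRhoConv` shows to converge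
for `s, u < √2 - 1`, i.e. `ρ, ρ̄ < 3 - 2√2`).

* `hasSum_zRhoConv_of_nonneg` — if `d ≥ 0` entrywise (MONOMIAL POSITIVITY), the double series
  `Σ_p d_p s^{p₁} u^{p₂}` converges to that function at EVERY point `0 < s, u < 1` of the `ρ`-square.
* `hasRadialExpansion_of_nonneg` — if moreover a non-negative table `w`, supported on `j ≤ ℓ + m`, has
  monomial array `d` (the unique candidate, `RadialConversion.radialMonArr_eq_zRhoConv_of_hasSum`),
  then `HasRadialExpansion c Δ w G` holds on the whole square: the radial expansion EXISTS.

Consequently the would-be block clause A2ρ of pub-ising3d (RADIAL-FRAME-DESIGN.md §3) reduces to a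
positivity clause on an explicit array; existence is a theorem.

Method. For fixed `s₀` the function `u ↦ Φ(s₀,u)` (the right-hand side above) is, after the substitution
`v = 2u/(1+u²) = √(z(u²))`, a product of positive real powers of `(1∓u²)/(1+u²)` and of the one-variable
series `v^{-(Δ-ℓ)} G(x₀, v²) = Σ_τ e_τ v^{m_τ}` (`lineCoeff`, `lineDeg`: non-negative coefficients, integer
exponents, convergent for `v < 1` because the `z`-series converges on the square); its complexification
(`lineC`, a locally uniformly convergent series of monomials on the unit disc, and complex powers off the
slit) is analytic at every real `u ∈ [0,1)` (`analyticAt_radialLineF`). Vivanti–Pringsheim in `u`, then —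
using the symmetry of `𝒫_{E,j}(x,y)` — in `s`, and Tonelli for the non-negative double family give the two
theorems. No value of any coefficient is used or computed.

What is NOT here: positivity of `zRhoConv` or of the table for the typed blocks (the remaining content
of A2ρ: Hogervorst–Rychkov 2013 (3.4) `B_{n,j} ≥ 0`, in print a consequence of unitarity, not of the
Casimir equation), and the signed expansion of the `⟨σεσε⟩` block.

Sources: M. Hogervorst, S. Rychkov, Phys. Rev. D 87 (2013) 106004, arXiv:1303.1111, §3, §3.1;
M. S. Costa, T. Hansen, J. Penedones, E. Trevisani, JHEP 07 (2016) 057, arXiv:1603.05552, §2.1;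
E. C. Titchmarsh, The Theory of Functions (1939) §7.21 (Vivanti–Pringsheim). Tree:
`RadialConversion` (`zRhoConv`, `hasSum_zRhoConv`, `zOfRho_sq`, `one_sub_zOfRho_sq`),
`RadialExpansionUniqueness` (`radialMonArr`, `radialArr`, `RadialSupport`), `MixedOddRadial`
(`HasRadialExpansion`, `radialMono`), `BlockZSeries` (`zMono`, `zMono_symm`),
`Literature.Analysis.Complex.PringsheimNonnegativeCoefficients`.
-/

noncomputable section

namespace Literature.MathematicalPhysics.QuantumFieldTheory.ConformalBootstrap3D

open Finset Set Filter
open scoped Topology BigOperators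

/-! ### §1. One `z`-monomial on a line `y = v²` -/

/-- The offset `a = ℓ + n - j ∈ ℕ` of a descendant index `q = (n,j)` (natural subtraction; meaningful on
the support `j ≤ ℓ + n`). [folklore] -/
def lineOff (ℓ : ℕ) (q : ℕ × ℕ) : ℕ := ℓ + q.1 - q.2

/-- The `v`-degree of the term `τ = (q, (i,k))`: `a + 2k`. [folklore] -/
def lineDeg (ℓ : ℕ) (τ : (ℕ × ℕ) × (ℕ × ℕ)) : ℕ := lineOff ℓ τ.1 + 2 * τ.2.2

/-- The coefficient of the term `τ = (q, (i,k))` of the one-variable series of `G(x, ·)` on the line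
`y = v²`: `A_q λ_i λ_k x^{(γ+a)/2 + i}` on the Legendre split `i + k = j`, `γ = Δ - ℓ`, `a = ℓ + n - j`;
zero off the split. [cite: HogervorstRychkov2013, §3 eq. (3.6)] -/
def lineCoeff (x Δ : ℝ) (ℓ : ℕ) (A : ℕ × ℕ → ℝ) (τ : (ℕ × ℕ) × (ℕ × ℕ)) : ℝ :=
  if τ.2.1 + τ.2.2 = τ.1.2 then
    A τ.1 * (legendreLam τ.2.1 * legendreLam τ.2.2) *
      x ^ (((Δ - (ℓ : ℝ)) + (lineOff ℓ τ.1 : ℝ)) / 2 + (τ.2.1 : ℝ))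
  else 0

/-- `lineCoeff ≥ 0` for `A ≥ 0`, `x ≥ 0`. [folklore] -/
theorem lineCoeff_nonneg {x Δ : ℝ} {ℓ : ℕ} {A : ℕ × ℕ → ℝ} (hA0 : ∀ q, 0 ≤ A q) (hx : 0 ≤ x)
    (τ : (ℕ × ℕ) × (ℕ × ℕ)) : 0 ≤ lineCoeff x Δ ℓ A τ := by
  unfold lineCoeff
  split_ifs
  · exact mul_nonneg (mul_nonneg (hA0 _) (mul_nonneg (legendreLam_pos _).le (legendreLam_pos _).le))
      (Real.rpow_nonneg hx _)
  · exact le_rfl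

/-- Off the Legendre split the coefficient vanishes. [folklore] -/
theorem lineCoeff_eq_zero_of_ne {x Δ : ℝ} {ℓ : ℕ} {A : ℕ × ℕ → ℝ} {τ : (ℕ × ℕ) × (ℕ × ℕ)}
    (h : τ.2.1 + τ.2.2 ≠ τ.1.2) : lineCoeff x Δ ℓ A τ = 0 := by
  unfold lineCoeff
  rw [if_neg h]

/-- The exponent identity on the support: `Δ + n - j = (Δ - ℓ) + a`, `a = ℓ + n - j`. [folklore] -/
theorem lineOff_cast {ℓ : ℕ} {q : ℕ × ℕ} (hq : q.2 ≤ ℓ + q.1) (Δ : ℝ) :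
    Δ + (q.1 : ℝ) - (q.2 : ℝ) = (Δ - (ℓ : ℝ)) + (lineOff ℓ q : ℝ) := by
  unfold lineOff
  push_cast [Nat.cast_sub hq]
  ring

/-- **One `z`-monomial on the line `y = v²`.** For `x, v > 0` and a descendant index `q = (n,j)`,
`j ≤ ℓ + n`:  `A_q 𝒫_{Δ+n,j}(x, v²) = v^{Δ-ℓ} Σ_{i+k=j} lineCoeff(q,(i,k)) v^{a+2k}`.
[cite: HogervorstRychkov2013, §3 eq. (3.6)] -/
theorem mul_zMono_line {x v Δ : ℝ} {ℓ : ℕ} (hx : 0 < x) (hv : 0 < v) (A : ℕ × ℕ → ℝ)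
    {q : ℕ × ℕ} (hq : q.2 ≤ ℓ + q.1) :
    A q * zMono (Δ + (q.1 : ℝ)) q.2 x (v ^ 2) =
      v ^ (Δ - (ℓ : ℝ)) * ∑ ck ∈ antidiagonal q.2, lineCoeff x Δ ℓ A (q, ck) * v ^ lineDeg ℓ (q, ck) := by
  set γ : ℝ := Δ - (ℓ : ℝ) with hγ
  have hv2 : 0 < v ^ 2 := by positivity
  -- the power prefactor
  have hpow : (x * v ^ 2) ^ ((Δ + (q.1 : ℝ) - (q.2 : ℝ)) / 2) =
      x ^ ((γ + (lineOff ℓ q : ℝ)) / 2) * (v ^ γ * v ^ lineOff ℓ q) := by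
    rw [lineOff_cast hq Δ, Real.mul_rpow hx.le hv2.le]
    congr 1
    rw [show v ^ 2 = v ^ ((2 : ℕ) : ℝ) by rw [Real.rpow_natCast], ← Real.rpow_mul hv.le,
      show ((2 : ℕ) : ℝ) * ((γ + (lineOff ℓ q : ℝ)) / 2) = γ + (lineOff ℓ q : ℝ) by push_cast; ring,
      Real.rpow_add hv, Real.rpow_natCast]
  unfold zMono zLegendre
  rw [hpow, mul_sum, mul_sum, mul_sum]
  refine sum_congr rfl fun ck hck => ?_
  rw [mem_antidiagonal] at hck
  have hcoef : lineCoeff x Δ ℓ A (q, ck) =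
      A q * (legendreLam ck.1 * legendreLam ck.2) * x ^ ((γ + (lineOff ℓ q : ℝ)) / 2 + (ck.1 : ℝ)) := by
    unfold lineCoeff
    rw [if_pos hck]
  rw [hcoef, Real.rpow_add hx, Real.rpow_natCast]
  unfold lineDeg
  simp only
  rw [pow_add, pow_mul]
  ring

/-! ### §2. The one-variable series of `G(x, v²)` -/

/-- One row of the line family: for a descendant index `q` the finitely many terms `(q,(i,k))`,
`i + k = j`, sum to `v^{-(Δ-ℓ)} A_q 𝒫_{Δ+n,j}(x, v²)`. [cite: HogervorstRychkov2013, §3 eq. (3.6)] -/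
theorem hasSum_lineCoeff_row {x v Δ : ℝ} {ℓ : ℕ} {A : ℕ × ℕ → ℝ} (hAs : RadialSupport ℓ A)
    (hx : 0 < x) (hv : 0 < v) (q : ℕ × ℕ) :
    HasSum (fun ck : ℕ × ℕ => lineCoeff x Δ ℓ A (q, ck) * v ^ lineDeg ℓ (q, ck))
      (v ^ (-(Δ - (ℓ : ℝ))) * (A q * zMono (Δ + (q.1 : ℝ)) q.2 x (v ^ 2))) := by
  have hvγ : 0 < v ^ (Δ - (ℓ : ℝ)) := Real.rpow_pos_of_pos hv _
  by_cases hq : q.2 ≤ ℓ + q.1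
  · have hval : v ^ (-(Δ - (ℓ : ℝ))) * (A q * zMono (Δ + (q.1 : ℝ)) q.2 x (v ^ 2)) =
        ∑ ck ∈ antidiagonal q.2, lineCoeff x Δ ℓ A (q, ck) * v ^ lineDeg ℓ (q, ck) := by
      rw [mul_zMono_line hx hv A hq, ← mul_assoc, Real.rpow_neg hv.le, inv_mul_cancel₀ hvγ.ne',
        one_mul]
    rw [hval]
    refine hasSum_sum_of_ne_finset_zero fun ck hck => ?_
    rw [lineCoeff_eq_zero_of_ne (by rwa [mem_antidiagonal] at hck), zero_mul]
  · have hA : A q = 0 := hAs q (not_le.mp hq)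
    have h0 : (fun ck : ℕ × ℕ => lineCoeff x Δ ℓ A (q, ck) * v ^ lineDeg ℓ (q, ck)) = fun _ => 0 := by
      funext ck
      unfold lineCoeff
      split_ifs
      · simp only [hA, zero_mul]
      · rw [zero_mul]
    rw [h0, hA, zero_mul, mul_zero]
    exact hasSum_zero

/-- **The line series (real form).** If `G(x,·)` has the `z`-expansion with array `A ≥ 0` supported on
`j ≤ ℓ + n` along the line `y = v²`, i.e. `Σ_q A_q 𝒫_{Δ+n,j}(x, v²) = g(v)` for `v ∈ (0,1)`, then the
non-negative family `τ ↦ lineCoeff τ · v^{lineDeg τ}` sums to `v^{-(Δ-ℓ)} g(v)`.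
[cite: HogervorstRychkov2013, §3 eq. (3.4)–(3.6)] -/
theorem hasSum_lineCoeff {x Δ : ℝ} {ℓ : ℕ} {A : ℕ × ℕ → ℝ} {g : ℝ → ℝ} (hA0 : ∀ q, 0 ≤ A q)
    (hAs : RadialSupport ℓ A) (hx0 : 0 < x)
    (hg : ∀ v : ℝ, v ∈ Ioo (0 : ℝ) 1 →
      HasSum (fun q : ℕ × ℕ => A q * zMono (Δ + (q.1 : ℝ)) q.2 x (v ^ 2)) (g v))
    {v : ℝ} (hv : v ∈ Ioo (0 : ℝ) 1) :
    HasSum (fun τ : (ℕ × ℕ) × (ℕ × ℕ) => lineCoeff x Δ ℓ A τ * v ^ lineDeg ℓ τ)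
      (v ^ (-(Δ - (ℓ : ℝ))) * g v) := by
  have hrow := fun q : ℕ × ℕ => hasSum_lineCoeff_row (Δ := Δ) hAs hx0 hv.1 q
  have hnn : ∀ τ : (ℕ × ℕ) × (ℕ × ℕ), 0 ≤ lineCoeff x Δ ℓ A τ * v ^ lineDeg ℓ τ := fun τ =>
    mul_nonneg (lineCoeff_nonneg hA0 hx0.le τ) (pow_nonneg hv.1.le _)
  have habs : ∀ q : ℕ × ℕ,
      Summable (fun ck : ℕ × ℕ => |lineCoeff x Δ ℓ A (q, ck) * v ^ lineDeg ℓ (q, ck)|) :=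
    fun q => (hrow q).summable.abs
  have hB : ∀ q : ℕ × ℕ, ∑' ck : ℕ × ℕ, |lineCoeff x Δ ℓ A (q, ck) * v ^ lineDeg ℓ (q, ck)| ≤
      v ^ (-(Δ - (ℓ : ℝ))) * (A q * zMono (Δ + (q.1 : ℝ)) q.2 x (v ^ 2)) := by
    intro q
    have h1 : ∑' ck : ℕ × ℕ, |lineCoeff x Δ ℓ A (q, ck) * v ^ lineDeg ℓ (q, ck)| =
        ∑' ck : ℕ × ℕ, lineCoeff x Δ ℓ A (q, ck) * v ^ lineDeg ℓ (q, ck) :=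
      tsum_congr fun ck => abs_of_nonneg (hnn _)
    rw [h1, (hrow q).tsum_eq]
  have htot : HasSum (fun q : ℕ × ℕ => v ^ (-(Δ - (ℓ : ℝ))) * (A q * zMono (Δ + (q.1 : ℝ)) q.2 x (v ^ 2)))
      (v ^ (-(Δ - (ℓ : ℝ))) * g v) := (hg v hv).mul_left _
  exact (hasSum_prod_assemble (U := fun τ : (ℕ × ℕ) × (ℕ × ℕ) => lineCoeff x Δ ℓ A τ * v ^ lineDeg ℓ τ)
    (r := fun q : ℕ × ℕ => v ^ (-(Δ - (ℓ : ℝ))) * (A q * zMono (Δ + (q.1 : ℝ)) q.2 x (v ^ 2)))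
    (B := fun q : ℕ × ℕ => v ^ (-(Δ - (ℓ : ℝ))) * (A q * zMono (Δ + (q.1 : ℝ)) q.2 x (v ^ 2)))
    hrow habs hB htot htot).1

/-- The line family is summable at every `v ∈ (0,1)` (non-negative terms). [folklore] -/
theorem summable_lineCoeff {x Δ : ℝ} {ℓ : ℕ} {A : ℕ × ℕ → ℝ} {g : ℝ → ℝ} (hA0 : ∀ q, 0 ≤ A q)
    (hAs : RadialSupport ℓ A) (hx0 : 0 < x)
    (hg : ∀ v : ℝ, v ∈ Ioo (0 : ℝ) 1 →
      HasSum (fun q : ℕ × ℕ => A q * zMono (Δ + (q.1 : ℝ)) q.2 x (v ^ 2)) (g v))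
    {v : ℝ} (hv : v ∈ Ioo (0 : ℝ) 1) :
    Summable (fun τ : (ℕ × ℕ) × (ℕ × ℕ) => lineCoeff x Δ ℓ A τ * v ^ lineDeg ℓ τ) :=
  (hasSum_lineCoeff hA0 hAs hx0 hg hv).summable

/-! ### §3. The complexified line series and its analyticity on the unit disc -/

/-- The complexified line series `Σ_τ e_τ V^{m_τ}` (a locally uniformly convergent series of monomials
on the unit disc). [folklore] -/
def lineC (x Δ : ℝ) (ℓ : ℕ) (A : ℕ × ℕ → ℝ) (V : ℂ) : ℂ :=
  ∑' τ : (ℕ × ℕ) × (ℕ × ℕ), (lineCoeff x Δ ℓ A τ : ℂ) * V ^ lineDeg ℓ τ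

/-- On a closed sub-disc `‖V‖ ≤ r < 1` the terms are dominated by the (convergent) real series at `r`,
so the complexified line series is complex-differentiable on the open unit disc. [folklore] -/
theorem differentiableOn_lineC {x Δ : ℝ} {ℓ : ℕ} {A : ℕ × ℕ → ℝ} {g : ℝ → ℝ} (hA0 : ∀ q, 0 ≤ A q)
    (hAs : RadialSupport ℓ A) (hx0 : 0 < x)
    (hg : ∀ v : ℝ, v ∈ Ioo (0 : ℝ) 1 →
      HasSum (fun q : ℕ × ℕ => A q * zMono (Δ + (q.1 : ℝ)) q.2 x (v ^ 2)) (g v))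
    {r : ℝ} (hr0 : 0 < r) (hr1 : r < 1) :
    DifferentiableOn ℂ (lineC x Δ ℓ A) (Metric.ball (0 : ℂ) r) := by
  have hsum := summable_lineCoeff hA0 hAs hx0 hg ⟨hr0, hr1⟩
  refine Complex.differentiableOn_tsum_of_summable_norm hsum (fun τ => ?_) Metric.isOpen_ball (fun τ V hV => ?_)
  · exact ((differentiable_id.pow _).const_mul _).differentiableOn
  · rw [Metric.mem_ball, dist_zero_right] at hV
    rw [norm_mul, norm_pow, Complex.norm_real, Real.norm_of_nonneg (lineCoeff_nonneg hA0 hx0.le τ)]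
    exact mul_le_mul_of_nonneg_left (pow_le_pow_left₀ (norm_nonneg _) hV.le _)
      (lineCoeff_nonneg hA0 hx0.le τ)

/-- The complexified line series is analytic at every point of the open unit disc. [folklore] -/
theorem analyticAt_lineC {x Δ : ℝ} {ℓ : ℕ} {A : ℕ × ℕ → ℝ} {g : ℝ → ℝ} (hA0 : ∀ q, 0 ≤ A q)
    (hAs : RadialSupport ℓ A) (hx0 : 0 < x)
    (hg : ∀ v : ℝ, v ∈ Ioo (0 : ℝ) 1 →
      HasSum (fun q : ℕ × ℕ => A q * zMono (Δ + (q.1 : ℝ)) q.2 x (v ^ 2)) (g v))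
    {V : ℂ} (hV : ‖V‖ < 1) : AnalyticAt ℂ (lineC x Δ ℓ A) V := by
  set r : ℝ := (‖V‖ + 1) / 2 with hr
  have hr0 : 0 < r := by rw [hr]; positivity
  have hr1 : r < 1 := by rw [hr]; linarith
  have hVr : ‖V‖ < r := by rw [hr]; linarith
  refine (differentiableOn_lineC hA0 hAs hx0 hg hr0 hr1).analyticAt ?_
  exact Metric.isOpen_ball.mem_nhds (by rwa [Metric.mem_ball, dist_zero_right])

/-- At a real point `v ∈ (0,1)` the complexified line series takes the real value `v^{-(Δ-ℓ)} g(v)`.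
[folklore] -/
theorem lineC_ofReal {x Δ : ℝ} {ℓ : ℕ} {A : ℕ × ℕ → ℝ} {g : ℝ → ℝ} (hA0 : ∀ q, 0 ≤ A q)
    (hAs : RadialSupport ℓ A) (hx0 : 0 < x)
    (hg : ∀ v : ℝ, v ∈ Ioo (0 : ℝ) 1 →
      HasSum (fun q : ℕ × ℕ => A q * zMono (Δ + (q.1 : ℝ)) q.2 x (v ^ 2)) (g v))
    {v : ℝ} (hv : v ∈ Ioo (0 : ℝ) 1) :
    lineC x Δ ℓ A (v : ℂ) = (((v ^ (-(Δ - (ℓ : ℝ))) * g v : ℝ)) : ℂ) := by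
  have h := hasSum_lineCoeff hA0 hAs hx0 hg hv
  have hC : HasSum (fun τ : (ℕ × ℕ) × (ℕ × ℕ) => ((lineCoeff x Δ ℓ A τ * v ^ lineDeg ℓ τ : ℝ) : ℂ))
      (((v ^ (-(Δ - (ℓ : ℝ))) * g v : ℝ)) : ℂ) := Complex.hasSum_ofReal.mpr h
  unfold lineC
  rw [← hC.tsum_eq]
  refine tsum_congr fun τ => ?_
  push_cast
  ring

/-! ### §4. The one-variable continuation function -/

/-- The continuation function of one variable:
`F(U) = C · ((1-U²)/(1+U²))^{2c} · (2/(1+U²))^{Δ-ℓ} · lineC(2U/(1+U²))` (principal complex powers).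
For real `U = u ∈ (0,1)` this is `C u^{-(Δ-ℓ)} (1 - z(u²))^c g(2u/(1+u²))` (`radialLineF_ofReal`).
[cite: HogervorstRychkov2013, §3.1] -/
def radialLineF (x Δ c C : ℝ) (ℓ : ℕ) (A : ℕ × ℕ → ℝ) (U : ℂ) : ℂ :=
  (C : ℂ) * ((((1 : ℂ) - U ^ 2) / (1 + U ^ 2)) ^ (((2 * c : ℝ)) : ℂ) *
    ((((2 : ℂ)) / (1 + U ^ 2)) ^ (((Δ - (ℓ : ℝ) : ℝ)) : ℂ) * lineC x Δ ℓ A (2 * U / (1 + U ^ 2))))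

/-- For real `t ∈ [0,1)`: `1 + t² ≠ 0` in `ℂ`, `(1-t²)/(1+t²) > 0`, `2/(1+t²) > 0`, `0 ≤ 2t/(1+t²) < 1`.
[folklore] -/
theorem radialLine_aux {t : ℝ} (ht0 : 0 ≤ t) (ht1 : t < 1) :
    (1 : ℂ) + (t : ℂ) ^ 2 ≠ 0 ∧ 0 < (1 - t ^ 2) / (1 + t ^ 2) ∧ 0 < 2 / (1 + t ^ 2) ∧
      0 ≤ 2 * t / (1 + t ^ 2) ∧ 2 * t / (1 + t ^ 2) < 1 := by
  have h1 : 0 < 1 + t ^ 2 := by positivity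
  have h2 : 0 < 1 - t ^ 2 := by nlinarith
  refine ⟨?_, div_pos h2 h1, div_pos two_pos h1, div_nonneg (by positivity) h1.le, ?_⟩
  · have : (1 : ℂ) + (t : ℂ) ^ 2 = ((1 + t ^ 2 : ℝ) : ℂ) := by push_cast; ring
    rw [this, Ne, Complex.ofReal_eq_zero]
    exact h1.ne'
  · rw [div_lt_one h1]
    nlinarith

/-- **Analyticity of the continuation function** at every real point of `[0,1)`.
[cite: HogervorstRychkov2013, §3.1] -/
theorem analyticAt_radialLineF {x Δ c C : ℝ} {ℓ : ℕ} {A : ℕ × ℕ → ℝ} {g : ℝ → ℝ} (hA0 : ∀ q, 0 ≤ A q)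
    (hAs : RadialSupport ℓ A) (hx0 : 0 < x)
    (hg : ∀ v : ℝ, v ∈ Ioo (0 : ℝ) 1 →
      HasSum (fun q : ℕ × ℕ => A q * zMono (Δ + (q.1 : ℝ)) q.2 x (v ^ 2)) (g v))
    {t : ℝ} (ht0 : 0 ≤ t) (ht1 : t < 1) : AnalyticAt ℂ (radialLineF x Δ c C ℓ A) t := by
  obtain ⟨hne, hpos1, hpos2, hv0, hv1⟩ := radialLine_aux ht0 ht1
  have hden : AnalyticAt ℂ (fun U : ℂ => (1 : ℂ) + U ^ 2) t :=
    analyticAt_const.add ((analyticAt_id).pow 2)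
  have hnum : AnalyticAt ℂ (fun U : ℂ => (1 : ℂ) - U ^ 2) t :=
    analyticAt_const.sub ((analyticAt_id).pow 2)
  have hq1 : AnalyticAt ℂ (fun U : ℂ => ((1 : ℂ) - U ^ 2) / (1 + U ^ 2)) t := hnum.div hden hne
  have hq2 : AnalyticAt ℂ (fun U : ℂ => (2 : ℂ) / (1 + U ^ 2)) t := analyticAt_const.div hden hne
  have hq3 : AnalyticAt ℂ (fun U : ℂ => 2 * U / (1 + U ^ 2)) t :=
    (analyticAt_const.mul analyticAt_id).div hden hne
  -- values at `t` lie in the slit plane / in the unit disc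
  have hval1 : ((1 : ℂ) - (t : ℂ) ^ 2) / (1 + (t : ℂ) ^ 2) ∈ Complex.slitPlane := by
    have : ((1 : ℂ) - (t : ℂ) ^ 2) / (1 + (t : ℂ) ^ 2) = (((1 - t ^ 2) / (1 + t ^ 2) : ℝ) : ℂ) := by
      push_cast; ring
    rw [this]
    exact Complex.ofReal_mem_slitPlane.mpr hpos1
  have hval2 : (2 : ℂ) / (1 + (t : ℂ) ^ 2) ∈ Complex.slitPlane := by
    have : (2 : ℂ) / (1 + (t : ℂ) ^ 2) = (((2 / (1 + t ^ 2) : ℝ)) : ℂ) := by push_cast; ring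
    rw [this]
    exact Complex.ofReal_mem_slitPlane.mpr hpos2
  have hval3 : ‖(2 * (t : ℂ) / (1 + (t : ℂ) ^ 2))‖ < 1 := by
    have : (2 * (t : ℂ) / (1 + (t : ℂ) ^ 2)) = (((2 * t / (1 + t ^ 2) : ℝ)) : ℂ) := by push_cast; ring
    rw [this, Complex.norm_real, Real.norm_of_nonneg hv0]
    exact hv1
  have hp1 : AnalyticAt ℂ (fun U : ℂ => (((1 : ℂ) - U ^ 2) / (1 + U ^ 2)) ^ (((2 * c : ℝ)) : ℂ)) t :=
    hq1.cpow analyticAt_const hval1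
  have hp2 : AnalyticAt ℂ (fun U : ℂ => ((2 : ℂ) / (1 + U ^ 2)) ^ (((Δ - (ℓ : ℝ) : ℝ)) : ℂ)) t :=
    hq2.cpow analyticAt_const hval2
  have hL : AnalyticAt ℂ (fun U : ℂ => lineC x Δ ℓ A (2 * U / (1 + U ^ 2))) t :=
    (analyticAt_lineC hA0 hAs hx0 hg hval3).comp (f := fun U : ℂ => 2 * U / (1 + U ^ 2)) hq3
  unfold radialLineF
  exact analyticAt_const.mul (hp1.mul (hp2.mul hL))

/-- The real function of one variable that the continuation function extends:
`Φ(u) = C u^{-(Δ-ℓ)} (1 - z(u²))^c g(2u/(1+u²))`. [cite: HogervorstRychkov2013, §3.1] -/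
def radialLineΦ (Δ c C : ℝ) (ℓ : ℕ) (g : ℝ → ℝ) (u : ℝ) : ℝ :=
  C * u ^ (-(Δ - (ℓ : ℝ))) * (1 - zOfRho (u ^ 2)) ^ c * g (2 * u / (1 + u ^ 2))

/-- **Real values of the continuation function**: for `t ∈ (0,1)`,
`F(t) = C t^{-(Δ-ℓ)} (1 - z(t²))^c g(2t/(1+t²))`. [cite: HogervorstRychkov2013, §3.1] -/
theorem radialLineF_ofReal {x Δ c C : ℝ} {ℓ : ℕ} {A : ℕ × ℕ → ℝ} {g : ℝ → ℝ} (hA0 : ∀ q, 0 ≤ A q)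
    (hAs : RadialSupport ℓ A) (hx0 : 0 < x)
    (hg : ∀ v : ℝ, v ∈ Ioo (0 : ℝ) 1 →
      HasSum (fun q : ℕ × ℕ => A q * zMono (Δ + (q.1 : ℝ)) q.2 x (v ^ 2)) (g v))
    {t : ℝ} (ht0 : 0 < t) (ht1 : t < 1) :
    radialLineF x Δ c C ℓ A t = ((radialLineΦ Δ c C ℓ g t : ℝ) : ℂ) := by
  obtain ⟨hne, hpos1, hpos2, hv0, hv1⟩ := radialLine_aux ht0.le ht1
  set γ : ℝ := Δ - (ℓ : ℝ) with hγ
  set v : ℝ := 2 * t / (1 + t ^ 2) with hv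
  have hvpos : 0 < v := by rw [hv]; positivity
  have h1t : 0 < 1 + t ^ 2 := by positivity
  -- complex → real
  have hc1 : ((1 : ℂ) - (t : ℂ) ^ 2) / (1 + (t : ℂ) ^ 2) = (((1 - t ^ 2) / (1 + t ^ 2) : ℝ) : ℂ) := by
    push_cast; ring
  have hc2 : (2 : ℂ) / (1 + (t : ℂ) ^ 2) = (((2 / (1 + t ^ 2) : ℝ)) : ℂ) := by push_cast; ring
  have hc3 : (2 * (t : ℂ) / (1 + (t : ℂ) ^ 2)) = ((v : ℝ) : ℂ) := by rw [hv]; push_cast; ring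
  have hL : lineC x Δ ℓ A (v : ℂ) = (((v ^ (-γ) * g v : ℝ)) : ℂ) := lineC_ofReal hA0 hAs hx0 hg ⟨hvpos, hv1⟩
  unfold radialLineF radialLineΦ
  rw [hc1, hc2, hc3, hL, ← Complex.ofReal_cpow hpos1.le, ← Complex.ofReal_cpow hpos2.le]
  -- the real identity
  have hz : (1 - zOfRho (t ^ 2)) ^ c = ((1 - t ^ 2) / (1 + t ^ 2)) ^ (2 * c) := by
    rw [one_sub_zOfRho_sq, ← Real.rpow_natCast ((1 - t ^ 2) / (1 + t ^ 2)) 2,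
      ← Real.rpow_mul hpos1.le]
    norm_num
  have hvγ : (2 / (1 + t ^ 2)) ^ γ * v ^ (-γ) = t ^ (-γ) := by
    rw [hv, show 2 * t / (1 + t ^ 2) = t * (2 / (1 + t ^ 2)) by ring,
      Real.mul_rpow ht0.le hpos2.le, Real.rpow_neg hpos2.le]
    have hne' : (2 / (1 + t ^ 2)) ^ γ ≠ 0 := (Real.rpow_pos_of_pos hpos2 γ).ne'
    field_simp
  rw [hz]
  push_cast
  rw [← hvγ]
  push_cast
  ring

/-! ### §5. One-variable continuation (Vivanti–Pringsheim) -/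

/-- **One-variable continuation.** If `β ≥ 0` and `∑_b β_b u^b = Φ(u)` on a small interval
`(0,u₁)`, then the same holds on all of `(0,1)`: `Φ` is the restriction of `radialLineF`, which is
analytic at every point of `[0,1)`, and a power series with non-negative coefficients converges (to
the continuation of its sum) up to the first singularity of its sum on the positive axis
(Vivanti–Pringsheim, `Literature.Analysis.Complex.hasSum_mul_pow_of_nonneg_of_analyticAt`).
[cite: HogervorstRychkov2013, §3.1], [cite: Titchmarsh1939, §7.21] -/
theorem hasSum_radialLine_extend {x Δ c C : ℝ} {ℓ : ℕ} {A : ℕ × ℕ → ℝ} {g : ℝ → ℝ}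
    (hA0 : ∀ q, 0 ≤ A q) (hAs : RadialSupport ℓ A) (hx0 : 0 < x)
    (hg : ∀ v : ℝ, v ∈ Ioo (0 : ℝ) 1 →
      HasSum (fun q : ℕ × ℕ => A q * zMono (Δ + (q.1 : ℝ)) q.2 x (v ^ 2)) (g v))
    {β : ℕ → ℝ} (hβ : ∀ b, 0 ≤ β b) {u₁ : ℝ} (hu₁ : 0 < u₁)
    (hsmall : ∀ u : ℝ, 0 < u → u < u₁ → HasSum (fun b => β b * u ^ b) (radialLineΦ Δ c C ℓ g u))
    {u : ℝ} (hu0 : 0 < u) (hu1 : u < 1) :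
    HasSum (fun b => β b * u ^ b) (radialLineΦ Δ c C ℓ g u) := by
  have hF : ∀ t : ℝ, 0 ≤ t → t < 1 → AnalyticAt ℂ (radialLineF x Δ c C ℓ A) t :=
    fun t ht0 ht1 => analyticAt_radialLineF hA0 hAs hx0 hg ht0 ht1
  have hgerm : ∀ t : ℝ, 0 < t → t < min u₁ 1 →
      HasSum (fun n => (β n : ℂ) * (t : ℂ) ^ n) (radialLineF x Δ c C ℓ A t) := by
    intro t ht0 ht1
    have ht1' : t < 1 := lt_of_lt_of_le ht1 (min_le_right _ _)
    have htu : t < u₁ := lt_of_lt_of_le ht1 (min_le_left _ _)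
    rw [radialLineF_ofReal hA0 hAs hx0 hg ht0 ht1']
    have h := Complex.hasSum_ofReal.mpr (hsmall t ht0 htu)
    simpa [Complex.ofReal_mul, Complex.ofReal_pow] using h
  have h := Literature.Analysis.Complex.hasSum_mul_pow_of_nonneg_of_analyticAt hβ hF
    (lt_min hu₁ one_pos) hgerm hu0 hu1
  rw [radialLineF_ofReal hA0 hAs hx0 hg hu0 hu1] at h
  have h' : HasSum (fun n => ((β n * u ^ n : ℝ) : ℂ)) ((radialLineΦ Δ c C ℓ g u : ℝ) : ℂ) := by
    simpa [Complex.ofReal_mul, Complex.ofReal_pow] using h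
  exact Complex.hasSum_ofReal.mp h'

/-! ### §6. Tonelli helpers and the value function -/

/-- The function the converted double series sums to (the right-hand side of
`RadialConversion.hasSum_zRhoConv`): `(su)^{-(Δ-ℓ)} 4^{-Δ} (1-z(s²))^c (1-z(u²))^c G(z(s²), z(u²))`.
[cite: HogervorstRychkov2013, §3 "first method"] -/
def zRhoValue (c Δ : ℝ) (ℓ : ℕ) (G : ℝ → ℝ → ℝ) (s u : ℝ) : ℝ :=
  (s * u) ^ (-(Δ - (ℓ : ℝ))) * (4 : ℝ) ^ (-Δ) *
    ((1 - zOfRho (s ^ 2)) ^ c * (1 - zOfRho (u ^ 2)) ^ c * G (zOfRho (s ^ 2)) (zOfRho (u ^ 2)))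

/-- Tonelli by rows: a non-negative family on `ℕ × ℕ` with summable rows whose row sums have sum `S`
has sum `S`. [folklore] -/
theorem hasSum_of_nonneg_of_hasSum_rows {f : ℕ × ℕ → ℝ} (hf : ∀ p, 0 ≤ f p)
    (hrow : ∀ a, Summable fun b => f (a, b)) {S : ℝ} (h : HasSum (fun a => ∑' b, f (a, b)) S) :
    HasSum f S := by
  have hs : Summable f := (summable_prod_of_nonneg fun p => hf p).mpr ⟨hrow, h.summable⟩
  have h2 : HasSum (fun a => ∑' b, f (a, b)) (∑' p, f p) :=
    hs.hasSum.prod_fiberwise fun a => (hrow a).hasSum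
  rw [← h2.unique h]
  exact hs.hasSum

/-- Tonelli by columns. [folklore] -/
theorem hasSum_of_nonneg_of_hasSum_cols {f : ℕ × ℕ → ℝ} (hf : ∀ p, 0 ≤ f p)
    (hcol : ∀ b, Summable fun a => f (a, b)) {S : ℝ} (h : HasSum (fun b => ∑' a, f (a, b)) S) :
    HasSum f S := by
  have h1 : HasSum (fun p : ℕ × ℕ => f p.swap) S :=
    hasSum_of_nonneg_of_hasSum_rows (fun p => hf p.swap) hcol h
  exact (Equiv.prodComm ℕ ℕ).hasSum_iff.mp h1

/-! ### §7. Convergence of the converted series on the whole `ρ`-square -/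

/-- Columns of the converted series converge for `s < √2 - 1` (a fibre of the absolutely convergent
double series of `hasSum_zRhoConv`). [cite: HogervorstRychkov2013, §3 "first method"] -/
theorem summable_zRhoConv_col {c Δ : ℝ} {ℓ : ℕ} {A : ℕ × ℕ → ℝ} {G : ℝ → ℝ → ℝ}
    (hA0 : ∀ q, 0 ≤ A q) (hAs : RadialSupport ℓ A) (hΔ : (ℓ : ℝ) ≤ Δ)
    (hz : ∀ x y : ℝ, x ∈ Ioo (0 : ℝ) 1 → y ∈ Ioo (0 : ℝ) 1 →
      HasSum (fun q : ℕ × ℕ => A q * zMono (Δ + (q.1 : ℝ)) q.2 x y) (G x y))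
    {s : ℝ} (hs0 : 0 < s) (hs1 : s < Real.sqrt 2 - 1) (b : ℕ) :
    Summable fun a : ℕ => zRhoConv c Δ ℓ A (a, b) * s ^ a := by
  have H := (hasSum_zRhoConv (c := c) hA0 hAs hΔ hz hs0 hs1 hs0 hs1).summable.prod_symm.prod_factor b
  have H' : Summable fun a : ℕ => zRhoConv c Δ ℓ A (a, b) * s ^ a * s ^ b :=
    H.congr fun a => by simp only [Prod.swap_prod_mk]; ring
  exact (summable_mul_right_iff (pow_ne_zero b hs0.ne')).mp H'

/-- **Step A (continuation in `u`).** For `0 < s < √2 - 1` and monomial positivity, the column sums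
`β_b(s) = Σ_a d_{a,b} s^a` satisfy `Σ_b β_b(s) u^b = Φ(s,u)` for EVERY `u ∈ (0,1)`.
[cite: HogervorstRychkov2013, §3.1] -/
theorem hasSum_zRhoConv_colSum {c Δ : ℝ} {ℓ : ℕ} {A : ℕ × ℕ → ℝ} {G : ℝ → ℝ → ℝ}
    (hA0 : ∀ q, 0 ≤ A q) (hAs : RadialSupport ℓ A) (hΔ : (ℓ : ℝ) ≤ Δ)
    (hz : ∀ x y : ℝ, x ∈ Ioo (0 : ℝ) 1 → y ∈ Ioo (0 : ℝ) 1 →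
      HasSum (fun q : ℕ × ℕ => A q * zMono (Δ + (q.1 : ℝ)) q.2 x y) (G x y))
    (hd : ∀ p, 0 ≤ zRhoConv c Δ ℓ A p) {s u : ℝ} (hs0 : 0 < s) (hs1 : s < Real.sqrt 2 - 1)
    (hu0 : 0 < u) (hu1 : u < 1) :
    HasSum (fun b : ℕ => (∑' a : ℕ, zRhoConv c Δ ℓ A (a, b) * s ^ a) * u ^ b)
      (zRhoValue c Δ ℓ G s u) := by
  have hs1' : s < 1 := hs1.trans sqrt_two_sub_one_lt_one
  have hx0 : zOfRho (s ^ 2) ∈ Ioo (0 : ℝ) 1 :=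
    ⟨zOfRho_pos (by positivity), zOfRho_lt_one (by nlinarith) (by nlinarith : s ^ 2 < 1).ne⟩
  have hg : ∀ v : ℝ, v ∈ Ioo (0 : ℝ) 1 → HasSum
      (fun q : ℕ × ℕ => A q * zMono (Δ + (q.1 : ℝ)) q.2 (zOfRho (s ^ 2)) (v ^ 2))
      ((fun v : ℝ => G (zOfRho (s ^ 2)) (v ^ 2)) v) :=
    fun v hv => hz _ _ hx0 ⟨by nlinarith [hv.1], by nlinarith [hv.1, hv.2]⟩
  have hval : ∀ u' : ℝ, 0 < u' → zRhoValue c Δ ℓ G s u' =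
      radialLineΦ Δ c (s ^ (-(Δ - (ℓ : ℝ))) * (4 : ℝ) ^ (-Δ) * (1 - zOfRho (s ^ 2)) ^ c) ℓ
        (fun v : ℝ => G (zOfRho (s ^ 2)) (v ^ 2)) u' := by
    intro u' hu'
    simp only [zRhoValue, radialLineΦ]
    rw [← zOfRho_sq u', Real.mul_rpow hs0.le hu'.le]
    ring
  have hsmall : ∀ u' : ℝ, 0 < u' → u' < Real.sqrt 2 - 1 →
      HasSum (fun b : ℕ => (∑' a : ℕ, zRhoConv c Δ ℓ A (a, b) * s ^ a) * u' ^ b)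
        (radialLineΦ Δ c (s ^ (-(Δ - (ℓ : ℝ))) * (4 : ℝ) ^ (-Δ) * (1 - zOfRho (s ^ 2)) ^ c) ℓ
          (fun v : ℝ => G (zOfRho (s ^ 2)) (v ^ 2)) u') := by
    intro u' hu0' hu1'
    rw [← hval u' hu0']
    have H := hasSum_zRhoConv (c := c) hA0 hAs hΔ hz hs0 hs1 hu0' hu1'
    have H2 : HasSum (fun p : ℕ × ℕ => zRhoConv c Δ ℓ A (p.2, p.1) * (s ^ p.2 * u' ^ p.1))
        (zRhoValue c Δ ℓ G s u') := (Equiv.prodComm ℕ ℕ).hasSum_iff.mpr H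
    refine H2.prod_fiberwise fun b => ?_
    have hcol := (summable_zRhoConv_col (c := c) hA0 hAs hΔ hz hs0 hs1 b).hasSum.mul_right (u' ^ b)
    simpa [mul_assoc] using hcol
  have hβ : ∀ b : ℕ, 0 ≤ ∑' a : ℕ, zRhoConv c Δ ℓ A (a, b) * s ^ a :=
    fun b => tsum_nonneg fun a => mul_nonneg (hd _) (pow_nonneg hs0.le _)
  rw [hval u hu0]
  exact hasSum_radialLine_extend hA0 hAs hx0.1 hg hβ sqrt_two_sub_one_pos hsmall hu0 hu1

/-- **Step A, double-series form**: convergence on the strip `0 < s < √2 - 1`, `0 < u < 1`.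
[cite: HogervorstRychkov2013, §3.1] -/
theorem hasSum_zRhoConv_strip {c Δ : ℝ} {ℓ : ℕ} {A : ℕ × ℕ → ℝ} {G : ℝ → ℝ → ℝ}
    (hA0 : ∀ q, 0 ≤ A q) (hAs : RadialSupport ℓ A) (hΔ : (ℓ : ℝ) ≤ Δ)
    (hz : ∀ x y : ℝ, x ∈ Ioo (0 : ℝ) 1 → y ∈ Ioo (0 : ℝ) 1 →
      HasSum (fun q : ℕ × ℕ => A q * zMono (Δ + (q.1 : ℝ)) q.2 x y) (G x y))
    (hd : ∀ p, 0 ≤ zRhoConv c Δ ℓ A p) {s u : ℝ} (hs0 : 0 < s) (hs1 : s < Real.sqrt 2 - 1)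
    (hu0 : 0 < u) (hu1 : u < 1) :
    HasSum (fun p : ℕ × ℕ => zRhoConv c Δ ℓ A p * (s ^ p.1 * u ^ p.2)) (zRhoValue c Δ ℓ G s u) := by
  refine hasSum_of_nonneg_of_hasSum_cols (fun p => mul_nonneg (hd p) (by positivity)) (fun b => ?_) ?_
  · have h := (summable_zRhoConv_col (c := c) hA0 hAs hΔ hz hs0 hs1 b).mul_right (u ^ b)
    simpa [mul_assoc] using h
  · refine (hasSum_zRhoConv_colSum hA0 hAs hΔ hz hd hs0 hs1 hu0 hu1).congr_fun fun b => ?_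
    rw [← tsum_mul_right]
    exact tsum_congr fun a => by ring

/-- Rows of the converted series converge for every `u < 1`. [cite: HogervorstRychkov2013, §3.1] -/
theorem summable_zRhoConv_row {c Δ : ℝ} {ℓ : ℕ} {A : ℕ × ℕ → ℝ} {G : ℝ → ℝ → ℝ}
    (hA0 : ∀ q, 0 ≤ A q) (hAs : RadialSupport ℓ A) (hΔ : (ℓ : ℝ) ≤ Δ)
    (hz : ∀ x y : ℝ, x ∈ Ioo (0 : ℝ) 1 → y ∈ Ioo (0 : ℝ) 1 →
      HasSum (fun q : ℕ × ℕ => A q * zMono (Δ + (q.1 : ℝ)) q.2 x y) (G x y))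
    (hd : ∀ p, 0 ≤ zRhoConv c Δ ℓ A p) {u : ℝ} (hu0 : 0 < u) (hu1 : u < 1) (a : ℕ) :
    Summable fun b : ℕ => zRhoConv c Δ ℓ A (a, b) * u ^ b := by
  have hs0 : 0 < (Real.sqrt 2 - 1) / 2 := by have := sqrt_two_sub_one_pos; positivity
  have hs1 : (Real.sqrt 2 - 1) / 2 < Real.sqrt 2 - 1 := by have := sqrt_two_sub_one_pos; linarith
  have H := (hasSum_zRhoConv_strip hA0 hAs hΔ hz hd hs0 hs1 hu0 hu1).summable.prod_factor a
  have H' : Summable fun b : ℕ => zRhoConv c Δ ℓ A (a, b) * u ^ b * ((Real.sqrt 2 - 1) / 2) ^ a :=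
    H.congr fun b => by ring
  exact (summable_mul_right_iff (pow_ne_zero a hs0.ne')).mp H'

/-- **Step B (continuation in `s`).** For every `u ∈ (0,1)` the row sums `α_a(u) = Σ_b d_{a,b} u^b`
satisfy `Σ_a α_a(u) s^a = Φ(s,u)` for EVERY `s ∈ (0,1)` (the symmetry `𝒫_{E,j}(x,y) = 𝒫_{E,j}(y,x)`
exchanges the roles of the two variables). [cite: HogervorstRychkov2013, §3.1] -/
theorem hasSum_zRhoConv_rowSum {c Δ : ℝ} {ℓ : ℕ} {A : ℕ × ℕ → ℝ} {G : ℝ → ℝ → ℝ}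
    (hA0 : ∀ q, 0 ≤ A q) (hAs : RadialSupport ℓ A) (hΔ : (ℓ : ℝ) ≤ Δ)
    (hz : ∀ x y : ℝ, x ∈ Ioo (0 : ℝ) 1 → y ∈ Ioo (0 : ℝ) 1 →
      HasSum (fun q : ℕ × ℕ => A q * zMono (Δ + (q.1 : ℝ)) q.2 x y) (G x y))
    (hd : ∀ p, 0 ≤ zRhoConv c Δ ℓ A p) {s u : ℝ} (hu0 : 0 < u) (hu1 : u < 1) (hs0 : 0 < s)
    (hs1 : s < 1) :
    HasSum (fun a : ℕ => (∑' b : ℕ, zRhoConv c Δ ℓ A (a, b) * u ^ b) * s ^ a)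
      (zRhoValue c Δ ℓ G s u) := by
  have hy0 : zOfRho (u ^ 2) ∈ Ioo (0 : ℝ) 1 :=
    ⟨zOfRho_pos (by positivity), zOfRho_lt_one (by nlinarith) (by nlinarith : u ^ 2 < 1).ne⟩
  have hg : ∀ v : ℝ, v ∈ Ioo (0 : ℝ) 1 → HasSum
      (fun q : ℕ × ℕ => A q * zMono (Δ + (q.1 : ℝ)) q.2 (zOfRho (u ^ 2)) (v ^ 2))
      ((fun v : ℝ => G (v ^ 2) (zOfRho (u ^ 2))) v) := by
    intro v hv
    have hv2 : v ^ 2 ∈ Ioo (0 : ℝ) 1 := ⟨by nlinarith [hv.1], by nlinarith [hv.1, hv.2]⟩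
    exact (hz _ _ hv2 hy0).congr_fun fun q => by rw [zMono_symm]
  have hval : ∀ s' : ℝ, 0 < s' → zRhoValue c Δ ℓ G s' u =
      radialLineΦ Δ c (u ^ (-(Δ - (ℓ : ℝ))) * (4 : ℝ) ^ (-Δ) * (1 - zOfRho (u ^ 2)) ^ c) ℓ
        (fun v : ℝ => G (v ^ 2) (zOfRho (u ^ 2))) s' := by
    intro s' hs'
    simp only [zRhoValue, radialLineΦ]
    rw [← zOfRho_sq s', Real.mul_rpow hs'.le hu0.le]
    ring
  have hsmall : ∀ s' : ℝ, 0 < s' → s' < Real.sqrt 2 - 1 →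
      HasSum (fun a : ℕ => (∑' b : ℕ, zRhoConv c Δ ℓ A (a, b) * u ^ b) * s' ^ a)
        (radialLineΦ Δ c (u ^ (-(Δ - (ℓ : ℝ))) * (4 : ℝ) ^ (-Δ) * (1 - zOfRho (u ^ 2)) ^ c) ℓ
          (fun v : ℝ => G (v ^ 2) (zOfRho (u ^ 2))) s') := by
    intro s' hs0' hs1'
    rw [← hval s' hs0']
    refine (hasSum_zRhoConv_strip hA0 hAs hΔ hz hd hs0' hs1' hu0 hu1).prod_fiberwise fun a => ?_
    have hrow := (summable_zRhoConv_row hA0 hAs hΔ hz hd hu0 hu1 a).hasSum.mul_right (s' ^ a)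
    exact hrow.congr_fun fun b => by ring
  have hα : ∀ a : ℕ, 0 ≤ ∑' b : ℕ, zRhoConv c Δ ℓ A (a, b) * u ^ b :=
    fun a => tsum_nonneg fun b => mul_nonneg (hd _) (pow_nonneg hu0.le _)
  rw [hval s hs0]
  exact hasSum_radialLine_extend hA0 hAs hy0.1 hg hα sqrt_two_sub_one_pos hsmall hs0 hs1

/-- **Convergence of the converted series on the whole `ρ`-square (value form).**
[cite: HogervorstRychkov2013, §3.1] -/
theorem hasSum_zRhoConv_value {c Δ : ℝ} {ℓ : ℕ} {A : ℕ × ℕ → ℝ} {G : ℝ → ℝ → ℝ}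
    (hA0 : ∀ q, 0 ≤ A q) (hAs : RadialSupport ℓ A) (hΔ : (ℓ : ℝ) ≤ Δ)
    (hz : ∀ x y : ℝ, x ∈ Ioo (0 : ℝ) 1 → y ∈ Ioo (0 : ℝ) 1 →
      HasSum (fun q : ℕ × ℕ => A q * zMono (Δ + (q.1 : ℝ)) q.2 x y) (G x y))
    (hd : ∀ p, 0 ≤ zRhoConv c Δ ℓ A p) {s u : ℝ} (hs0 : 0 < s) (hs1 : s < 1) (hu0 : 0 < u)
    (hu1 : u < 1) :
    HasSum (fun p : ℕ × ℕ => zRhoConv c Δ ℓ A p * (s ^ p.1 * u ^ p.2)) (zRhoValue c Δ ℓ G s u) := by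
  refine hasSum_of_nonneg_of_hasSum_rows (fun p => mul_nonneg (hd p) (by positivity)) (fun a => ?_) ?_
  · exact ((summable_zRhoConv_row hA0 hAs hΔ hz hd hu0 hu1 a).mul_right (s ^ a)).congr
      fun b => by ring
  · refine (hasSum_zRhoConv_rowSum hA0 hAs hΔ hz hd hu0 hu1 hs0 hs1).congr_fun fun a => ?_
    rw [← tsum_mul_right]
    exact tsum_congr fun b => by ring

/-- **Monomial positivity ⇒ convergence on the whole `ρ`-square.** Under the hypotheses of
`RadialConversion.hasSum_zRhoConv` (`A ≥ 0` supported on `j ≤ ℓ + n`, `ℓ ≤ Δ`, the `z`-series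
converging to `G` on the unit square), if the conversion array `d = zRhoConv c Δ ℓ A` is entrywise
non-negative then `Σ_p d_p s^{p₁} u^{p₂}` converges to
`(su)^{-(Δ-ℓ)} 4^{-Δ} (1-z(s²))^c (1-z(u²))^c G(z(s²), z(u²))` at EVERY point `0 < s, u < 1`
(i.e. on the whole unit `ρ`-square, `(ρ, ρ̄) = (s², u²)`), not only for `s, u < √2 - 1`.
This is Hogervorst–Rychkov's §3.1 argument ("all terms in the series are positive, and so the
series must converge — a divergence here would mean a … singularity") carried out one variable at
a time by the Vivanti–Pringsheim theorem, the analyticity along the segment being supplied by the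
convergent `z`-series. [cite: HogervorstRychkov2013, §3.1], [cite: Titchmarsh1939, §7.21] -/
theorem hasSum_zRhoConv_of_nonneg {c Δ : ℝ} {ℓ : ℕ} {A : ℕ × ℕ → ℝ} {G : ℝ → ℝ → ℝ}
    (hA0 : ∀ q, 0 ≤ A q) (hAs : RadialSupport ℓ A) (hΔ : (ℓ : ℝ) ≤ Δ)
    (hz : ∀ x y : ℝ, x ∈ Ioo (0 : ℝ) 1 → y ∈ Ioo (0 : ℝ) 1 →
      HasSum (fun q : ℕ × ℕ => A q * zMono (Δ + (q.1 : ℝ)) q.2 x y) (G x y))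
    (hd : ∀ p, 0 ≤ zRhoConv c Δ ℓ A p) {s u : ℝ} (hs0 : 0 < s) (hs1 : s < 1) (hu0 : 0 < u)
    (hu1 : u < 1) :
    HasSum (fun p : ℕ × ℕ => zRhoConv c Δ ℓ A p * (s ^ p.1 * u ^ p.2))
      ((s * u) ^ (-(Δ - (ℓ : ℝ))) * (4 : ℝ) ^ (-Δ) *
        ((1 - zOfRho (s ^ 2)) ^ c * (1 - zOfRho (u ^ 2)) ^ c *
          G (zOfRho (s ^ 2)) (zOfRho (u ^ 2)))) := by
  have h := hasSum_zRhoConv_value hA0 hAs hΔ hz hd hs0 hs1 hu0 hu1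
  simp only [zRhoValue] at h
  exact h

/-! ### §8. Existence of the radial expansion -/

/-- **Positivity ⇒ existence of the radial expansion.** Under the hypotheses of
`hasSum_zRhoConv_of_nonneg`, if a non-negative table `w ≥ 0` supported on `j ≤ ℓ + m` has
`(√ρ,√ρ̄)`-monomial array `radialMonArr ℓ w = zRhoConv c Δ ℓ A` (the unique candidate:
`RadialConversion.radialMonArr_eq_zRhoConv_of_hasSum`), then `HasRadialExpansion c Δ w G` holds:
`((1-z)(1-z̄))^c G(z,z̄) = Σ_{(m,j)} 4^Δ w(m,j) 𝒫^ρ_{Δ+m,j}` as an unconditionally convergent double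
series at every point of the open unit square. (Regroup the convergent non-negative monomial series
by antidiagonals `a + b = 2(ℓ+m)` — these are the level-`m` rows of the radial series by
Hogervorst–Rychkov 2013 eq. (3.6) — and apply Tonelli to the non-negative radial family.)
[cite: HogervorstRychkov2013, §3 eqs. (3.4)–(3.6), §3.1],
[cite: CostaHansenPenedonesTrevisani2016, §2.1 eq. (2.11)] -/
theorem hasRadialExpansion_of_nonneg {c Δ : ℝ} {ℓ : ℕ} {A : ℕ × ℕ → ℝ} {G : ℝ → ℝ → ℝ}
    (hA0 : ∀ q, 0 ≤ A q) (hAs : RadialSupport ℓ A) (hΔ : (ℓ : ℝ) ≤ Δ)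
    (hz : ∀ x y : ℝ, x ∈ Ioo (0 : ℝ) 1 → y ∈ Ioo (0 : ℝ) 1 →
      HasSum (fun q : ℕ × ℕ => A q * zMono (Δ + (q.1 : ℝ)) q.2 x y) (G x y))
    (hd : ∀ p, 0 ≤ zRhoConv c Δ ℓ A p) {w : ℕ × ℕ → ℝ} (hw0 : ∀ q, 0 ≤ w q)
    (hws : RadialSupport ℓ w) (hmon : radialMonArr ℓ w = zRhoConv c Δ ℓ A) :
    HasRadialExpansion c Δ w G := by
  intro x y hx hy
  -- square-root radial coordinates `x = z(s²)`, `y = z(u²)`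
  obtain ⟨s, hs0, hs1, hs2⟩ : ∃ s : ℝ, 0 < s ∧ s < 1 ∧ s ^ 2 = rhoOf x :=
    ⟨Real.sqrt (rhoOf x), Real.sqrt_pos.mpr (rhoOf_pos hx.1),
      (Real.sqrt_lt' one_pos).mpr (by rw [one_pow]; exact rhoOf_lt_one hx.2),
      Real.sq_sqrt (rhoOf_pos hx.1).le⟩
  obtain ⟨u, hu0, hu1, hu2⟩ : ∃ u : ℝ, 0 < u ∧ u < 1 ∧ u ^ 2 = rhoOf y :=
    ⟨Real.sqrt (rhoOf y), Real.sqrt_pos.mpr (rhoOf_pos hy.1),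
      (Real.sqrt_lt' one_pos).mpr (by rw [one_pow]; exact rhoOf_lt_one hy.2),
      Real.sq_sqrt (rhoOf_pos hy.1).le⟩
  have hxz : zOfRho (s ^ 2) = x := by rw [hs2]; exact zOfRho_rhoOf hx.2.le
  have hyz : zOfRho (u ^ 2) = y := by rw [hu2]; exact zOfRho_rhoOf hy.2.le
  have hsu : 0 < s * u := mul_pos hs0 hu0
  -- the monomial series and its antidiagonal block sums
  have hE : HasSum (fun p : ℕ × ℕ => radialMonArr ℓ w p * s ^ p.1 * u ^ p.2)
      (zRhoValue c Δ ℓ G s u) := by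
    rw [hmon]
    exact (hasSum_zRhoConv_value hA0 hAs hΔ hz hd hs0 hs1 hu0 hu1).congr_fun fun p => by ring
  have hblk : HasSum (fun N : ℕ => ∑ p ∈ antidiagonal N, radialMonArr ℓ w p * s ^ p.1 * u ^ p.2)
      (zRhoValue c Δ ℓ G s u) := by
    have h := hasSum_sum_antidiagonal_of_summable hE.summable
    rwa [hE.tsum_eq] at h
  have hinj : Function.Injective (fun m : ℕ => 2 * (ℓ + m)) := fun a b hab => by
    simp only at hab
    omega
  have hoff : ∀ N ∉ Set.range (fun m : ℕ => 2 * (ℓ + m)),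
      ∑ p ∈ antidiagonal N, radialMonArr ℓ w p * s ^ p.1 * u ^ p.2 = 0 := by
    intro N hN
    refine sum_eq_zero fun p hp => ?_
    rw [mem_antidiagonal] at hp
    have h0 : radialMonArr ℓ w p = 0 := by
      unfold radialMonArr
      rw [if_neg]
      rintro ⟨he, hle⟩
      exact hN ⟨(p.1 + p.2) / 2 - ℓ, by simp only; omega⟩
    rw [h0, zero_mul, zero_mul]
  have hblk2 : HasSum
      (fun m : ℕ => ∑ p ∈ antidiagonal (2 * (ℓ + m)), radialMonArr ℓ w p * s ^ p.1 * u ^ p.2)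
      (zRhoValue c Δ ℓ G s u) := (hinj.hasSum_iff hoff).mpr hblk
  -- the rows of the radial family are these block sums (Hogervorst–Rychkov (3.6))
  have hrows : HasSum
      (fun m : ℕ => ∑ j ∈ range (ℓ + m + 1), w (m, j) * zMono (Δ + (m : ℝ)) j (s ^ 2) (u ^ 2))
      ((s * u) ^ (Δ - (ℓ : ℝ)) * zRhoValue c Δ ℓ G s u) := by
    refine (hblk2.mul_left ((s * u) ^ (Δ - (ℓ : ℝ)))).congr_fun fun m => ?_
    rw [sum_row_eq_mul_sum_antidiagonal w hs0 hu0 m]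
  have hrow : ∀ m : ℕ, HasSum (fun j : ℕ => w (m, j) * zMono (Δ + (m : ℝ)) j (s ^ 2) (u ^ 2))
      (∑ j ∈ range (ℓ + m + 1), w (m, j) * zMono (Δ + (m : ℝ)) j (s ^ 2) (u ^ 2)) := by
    intro m
    refine hasSum_sum_of_ne_finset_zero fun j hj => ?_
    rw [Finset.mem_range, not_lt] at hj
    rw [hws (m, j) (by simp only; omega), zero_mul]
  have htsum : HasSum
      (fun m : ℕ => ∑' j : ℕ, w (m, j) * zMono (Δ + (m : ℝ)) j (s ^ 2) (u ^ 2))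
      ((s * u) ^ (Δ - (ℓ : ℝ)) * zRhoValue c Δ ℓ G s u) := by
    refine hrows.congr_fun fun m => ?_
    rw [(hrow m).tsum_eq]
  -- Tonelli for the non-negative radial family
  have key : HasSum (fun q : ℕ × ℕ => w q * zMono (Δ + (q.1 : ℝ)) q.2 (s ^ 2) (u ^ 2))
      ((s * u) ^ (Δ - (ℓ : ℝ)) * zRhoValue c Δ ℓ G s u) := by
    refine hasSum_of_nonneg_of_hasSum_rows
      (f := fun q : ℕ × ℕ => w q * zMono (Δ + (q.1 : ℝ)) q.2 (s ^ 2) (u ^ 2))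
      (fun q => mul_nonneg (hw0 q) (zMono_nonneg _ _ (sq_nonneg s) (sq_nonneg u))) (fun m => ?_) ?_
    · exact (hrow m).summable
    · exact htsum
  -- the value
  have h1 : (s * u) ^ (Δ - (ℓ : ℝ)) ≠ 0 := (Real.rpow_pos_of_pos hsu _).ne'
  have h2 : (4 : ℝ) ^ Δ ≠ 0 := (Real.rpow_pos_of_pos (by norm_num) _).ne'
  have hval : (4 : ℝ) ^ Δ * ((s * u) ^ (Δ - (ℓ : ℝ)) * zRhoValue c Δ ℓ G s u) =
      ((1 - x) * (1 - y)) ^ c * G x y := by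
    have hr1 : ((1 - x) * (1 - y)) ^ c = (1 - x) ^ c * (1 - y) ^ c :=
      Real.mul_rpow (by linarith [hx.2]) (by linarith [hy.2])
    have hr2 : (s * u) ^ (-(Δ - (ℓ : ℝ))) = ((s * u) ^ (Δ - (ℓ : ℝ)))⁻¹ := Real.rpow_neg hsu.le _
    have hr3 : (4 : ℝ) ^ (-Δ) = ((4 : ℝ) ^ Δ)⁻¹ := Real.rpow_neg (by norm_num) _
    unfold zRhoValue
    rw [hxz, hyz, hr1, hr2, hr3]
    calc (4 : ℝ) ^ Δ * ((s * u) ^ (Δ - (ℓ : ℝ)) * (((s * u) ^ (Δ - (ℓ : ℝ)))⁻¹ * ((4 : ℝ) ^ Δ)⁻¹ *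
          ((1 - x) ^ c * (1 - y) ^ c * G x y)))
        = ((4 : ℝ) ^ Δ * ((4 : ℝ) ^ Δ)⁻¹) * ((s * u) ^ (Δ - (ℓ : ℝ)) * ((s * u) ^ (Δ - (ℓ : ℝ)))⁻¹) *
            ((1 - x) ^ c * (1 - y) ^ c * G x y) := by ring
      _ = (1 - x) ^ c * (1 - y) ^ c * G x y := by
          rw [mul_inv_cancel₀ h2, mul_inv_cancel₀ h1, one_mul, one_mul]
  have key2 := key.mul_left ((4 : ℝ) ^ Δ)
  rw [hval] at key2
  refine key2.congr_fun fun q => ?_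
  simp only [radialMono]
  rw [← hs2, ← hu2]
  ring

/-! ### §9. Table positivity alone suffices (the `hd` clause is redundant) -/

/-- If a non-negative table `w ≥ 0` has monomial array `radialMonArr ℓ w = zRhoConv c Δ ℓ A`, then the
conversion array is non-negative (`radialArr ≥ 0`): the hypothesis `hd` of `hasRadialExpansion_of_nonneg`
FOLLOWS from `hw0` and `hmon` (pub-ising3d REFEREE r51, W20). [folklore] -/
theorem zRhoConv_nonneg_of_table {c Δ : ℝ} {ℓ : ℕ} {A w : ℕ × ℕ → ℝ} (hw0 : ∀ q, 0 ≤ w q)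
    (hmon : radialMonArr ℓ w = zRhoConv c Δ ℓ A) : ∀ p, 0 ≤ zRhoConv c Δ ℓ A p := by
  intro p
  rw [← hmon]
  unfold radialMonArr
  split_ifs
  · exact sum_nonneg fun j _ => mul_nonneg (hw0 _) (radialArr_nonneg _ _ _)
  · exact le_rfl

/-- **Positivity of the radial TABLE ⇒ existence of the radial expansion** — `hasRadialExpansion_of_nonneg`
with its redundant hypothesis `hd` discharged: under the `z`-side hypotheses of `hasSum_zRhoConv`, a
non-negative table `w ≥ 0` supported on `j ≤ ℓ + m` with `radialMonArr ℓ w = zRhoConv c Δ ℓ A` gives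
`HasRadialExpansion c Δ w G` on the whole open square. This is the form in which RECIPE R17(i) states the
radial pair clause: ONE inequality family `w ≥ 0` (Hogervorst–Rychkov's `B_{n,j} ≥ 0`).
[cite: HogervorstRychkov2013, §3.1] -/
theorem hasRadialExpansion_of_table_nonneg {c Δ : ℝ} {ℓ : ℕ} {A : ℕ × ℕ → ℝ} {G : ℝ → ℝ → ℝ}
    (hA0 : ∀ q, 0 ≤ A q) (hAs : RadialSupport ℓ A) (hΔ : (ℓ : ℝ) ≤ Δ)
    (hz : ∀ x y : ℝ, x ∈ Ioo (0 : ℝ) 1 → y ∈ Ioo (0 : ℝ) 1 →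
      HasSum (fun q : ℕ × ℕ => A q * zMono (Δ + (q.1 : ℝ)) q.2 x y) (G x y))
    {w : ℕ × ℕ → ℝ} (hw0 : ∀ q, 0 ≤ w q) (hws : RadialSupport ℓ w)
    (hmon : radialMonArr ℓ w = zRhoConv c Δ ℓ A) :
    HasRadialExpansion c Δ w G :=
  hasRadialExpansion_of_nonneg hA0 hAs hΔ hz (zRhoConv_nonneg_of_table hw0 hmon) hw0 hws hmon

end Literature.MathematicalPhysics.QuantumFieldTheory.ConformalBootstrap3D

end
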